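import Literature.MathematicalPhysics.QuantumFieldTheory.Balaban1983to89.B4Lemma21Region

/-!
# B4 p. 581, proof of Lemma 2.2 — the reduction of a general regular `Ã` to a constant `A₀`, (2.31)–(2.33),
as kernel theorems

T. Bałaban, *Regularity and decay of lattice Green's functions*, Commun. Math. Phys. **89** (1983) 571–597 (= B4),
p. 581 [PDF 11] (transcript `HOME/b2b-balaban-b04/transcript-B4.md` ll. 157–167), verbatim:
«Proof of Lemma 2.2. It is much longer and will be reduced to some other lemmas again. We start with the same
operations as in the proof of Lemma 2.2 ⟦sic: 2.1⟧ and we have the representation (2.26) for e sufficiently small,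
which we can write in the following form (2.31) G_k(□,Ã) = Σ_{n=0}^∞ G_k(□,A₀)(V_kG_k(□,A₀))^n.»
«The series in (2.31) is convergent in L²(□), but we will prove that it is in fact convergent in stronger norms
appearing in formulation of Lemma 2.2. Let us assume that Lemma 2.2 holds for G_k(□,A₀) with constant configurations
A₀. We will prove it for a general case using (2.31). At first let us observe that V_k can be interpreted as a first
order differential operator acting on a function on the right hand side of it.» (then (2.32): the term
`D^{η*}_{A₀}F_{1,k}(−A')` rewritten by the product rule) «Thus it is a first order differential operator with small
coefficients. Only here we needed the assumption that Ã is constant in a neighbourhood of ∂□. Now using Lemma 2.2 for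
G_k(□,A₀) and the decomposition D^η_Ã = U(A')D^η_{A₀} + F_{1,k}(A'), we have
(2.33) ‖G_k(□,Ã)f‖_{1,α} ≤ O(1)c₁ Σ_{n=0}^∞ ‖(V_kG_k(□,A₀))^n f‖_∞ ≤ O(1)c₁ Σ_{n=0}^∞ (O(1)e^β c₂)^n ‖f‖_∞.
The series on the right hand side is convergent for e sufficiently small, and we get the inequality (2.16). The
inequality (2.17) is proved in the same way.»
Also p. 580 [PDF 10] (proof of Lemma 2.1, transcript ll. 136–139): «Taking into account the bound (2.23) and the
inequalities» [(2.25)] «holding for some absolute constant c₀, we can easily prove that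
‖G_k^{1/2}(□,A₀)V_kG_k^{1/2}(□,A₀)‖_{2,2} ≤ O(1)e^β, with a constant O(1) depending on M only. For e sufficiently
small, we get the representation» [(2.26)] (the resolvent form behind (2.31)).

v1.1 (DOCFIX, 2026-08-19; XREAD C-pv09g9-11 D1 + self-audit of every «» unit against transcript-B4.md): three
non-printed phrases formerly set in «» (a summary of (2.25), the title's and the scope's one-line summaries of the
step) are now plain text or the verbatim sentences; two clipped quotations completed; no Lean statement or proof
changed.

## What is certified here (kernel theorems; HONEST SCOPE below)

THE INFERENCE STEP of the quotation, in operator form over the block calculus of `B4GaugeCovariance` (sites `X`,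
colours `ι`, configurations `Φ : X × ι → ℝ`, operators = matrices on `X × ι`):

* §1–§2: the mixed norms in which «stronger norms» are measured: the Euclidean site norm `|φ(x)|`
  (`B4Lemma21Region.siteNorm`, triangle inequality `siteNorm_add_le`, Cauchy–Schwarz `abs_dot_le`), the sup norm
  `supN Φ = sup_x |φ(x)|` = ‖·‖_∞ of (2.17) and the `ℓ¹` norm `l1N Φ = Σ_x |φ(x)|` (both subadditive, nonnegative).
* §3 (**the reduction, resolvent form — `bootstrap`**): for ANY nonnegative subadditive functional `ν` (e.g. `supN`,
  `l1N`), matrices `G, G₀, V` with THE RESOLVENT IDENTITY `G = G₀ + G₀VG` behind (2.26)/(2.31)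
  (`B4Lower18Regular.inv_sub_eq` for `H = H₀ − V`), a finite family of «first order» operators `D_μ` (`μ ∈ κ`,
  `m = card κ`; in [B4]: `D^η_{A₀,μ}`, `μ = 1,…,d`): IF «Lemma 2.2 holds for G_k(□,A₀)» in the form
  `ν(G₀Φ) ≤ c·νΦ`, `ν(D_μG₀Φ) ≤ c·νΦ` ((2.17) with `p = q = ∞`, `n = 0, 1`, when `ν = supN`) AND `V` «is a first order
  differential operator with small coefficients»: `ν(Vu) ≤ ε(νu + Σ_μ ν(D_μu))`, AND the smallness `(m+1)cε ≤ 1/2`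
  («for e sufficiently small»), THEN `ν(GΦ) + Σ_μ ν(D_μGΦ) ≤ 2(m+1)c·νΦ` — the bounds for `G_k(□,Ã)` and
  `D^η_{A₀,μ}G_k(□,Ã)` (`bootstrap_green`, `bootstrap_deriv`).  No series is summed: in finite dimension the resolvent
  identity and the a-priori existence of `G` make (2.33) a one-line absorption.  The SHAPE of (2.32) — an operator
  `V = E₀ + Σ_μ E_μD_μ` with `ν`-small coefficients is first-order small — is `firstOrderSmall_of_decomp`.
* §4 (**the transfer (2.33) to «stronger norms»** — `transfer`): for ANY subadditive functional `N` (in [B4]: the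
  Hölder norm `‖·‖_{1,α}` of (2.14), or an `L^q` norm of (2.17)) with the `A₀`-bound `N(G₀Φ) ≤ c₁·νΦ` ((2.16) for
  `G_k(□,A₀)`): `N(GΦ) ≤ 2c₁·νΦ` — (2.16)/(2.17) for `G_k(□,Ã)` with the constant doubled («O(1)c₁»).
* §5 (**the literal Neumann form (2.31)/(2.33)**): `θ = (m+1)cε` bounds `ν(VG₀g) ≤ θ·νg` (`neumannStep`), hence
  `ν((VG₀)^n g) ≤ θ^n νg` (`neumannPow`) and the partial sums of (2.31) obey the printed geometric bound
  `N(Σ_{n<K} G₀(VG₀)^n f) ≤ c₁(Σ_{n<K} θ^n)·νf ≤ c₁/(1−θ)·νf` for `θ < 1` (`partialSum_le`, `partialSum_le_geom`); the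
  finite expansion with remainder in the printed ordering is `expansion231` (from `B4Lower18Regular.inv_sub_expand`
  + `pow_mul_shift`) and the remainder is geometrically small, `ν((G₀V)^{K+1}G f) ≤ cθ^K·νf` (`remainder_le`) — the
  series (2.31) converges to `G` in every such `ν` («convergent in stronger norms»).
* §6 (**«the decomposition D^η_Ã = U(A')D^η_{A₀} + F_{1,k}(A')»** — `deriv_convert`): if `D'_μ − D_μ` is first-order
  small with constant `φ`, then `ν(D'_μGΦ) ≤ (1+φ)·2(m+1)c·νΦ` — the bound for `D^η_{Ã,μ}G_k(□,Ã)`.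
* §7 (**«(2.17) is proved in the same way»**, the clause `G_k(□,Ã)D^{η*}_{Ã,μ}` at `q = ∞`): DUALITY
  `supN ((Tᵀ)g) ≤ B·supN g` from `l1N(TΦ) ≤ B·l1N Φ` (`supN_transpose_le`), so the `ℓ¹` instance of §3 for `D_μG`
  gives the sup bound for `GD_μ^* = (D_μG)ᵀ` when `Gᵀ = G` (`bootstrap_dual`).
* §8: the `supN` and `l1N` instances (`reduce_sup`, `reduce_sup_inv` for `G = (H₀ − V)⁻¹`, `reduce_l1`) and a toy
  instance (`X = ι = κ = Unit`, `H₀ = 2`, `V = 1/2 ≠ 0`, `D = 1`, `toy_reduce`) meeting every hypothesis of §3 with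
  `ν = supN`, so the hypotheses are jointly satisfiable with a non-zero perturbation.

## HONEST SCOPE

* This module certifies the LOGICAL STEP "Lemma 2.2 for `G_k(□,A₀)` + `V_k` first order with small coefficients ⇒
  Lemma 2.2 for `G_k(□,Ã)`" (our summary, not a quotation) as an abstract operator theorem (any finite site set, any
  colour set, any finite family `D_μ`, any nonnegative subadditive `ν`).  It does NOT verify for [B4]'s concrete
  `V_k` ((2.24)–(2.25), (2.32)) the first-order smallness `ν(V_ku) ≤ ε(…)` with `ε = O(e^β c₂)` from (1.7) and «Ã is
  constant in a neighbourhood of ∂□» — that is a separate node (the form-level smallness used for Lemma 2.1 is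
  `B4Lower18Regular.pertE_site_bound` /
  `pertT_bound`); NOR the constant-configuration bounds themselves (reduced in print to `A₀ = 0` by the gauge
  transformation — in tree: `B4GaugeCovariance.b4Green_constBond`, `thm110_const_box_value`; the `A = 0` Lemma 2.2 is
  the `B4Lemma22ZeroBox*` / `B4Thm110ZeroBox*` chain).
* Constants: the printed `O(1)c₁ Σ (O(1)e^βc₂)^n` becomes `2c₁` under `(m+1)cε ≤ 1/2` (i.e. `θ ≤ 1/2`); §5 keeps the
  geometric-series shape `c₁/(1−θ)` for `θ < 1`.
* No step of the paper is used as a hypothesis of a theorem claiming a printed conclusion; 0 cited facts.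

Value = kernel certificate of a printed inference step (operator form), NOT summit progress.
-/

namespace Literature.MathematicalPhysics.QuantumFieldTheory.Balaban1983to89.B4Lemma22Reduce231

open Finset Matrix
open Literature.MathematicalPhysics.QuantumFieldTheory.Balaban1983to89.B4GaugeCovariance (fld fld_apply)
open Literature.MathematicalPhysics.QuantumFieldTheory.Balaban1983to89.B4Lower18Regular (dotProduct_self_nonneg'
  dotProduct_eq_sum_fld inv_sub_eq inv_sub_expand pow_mul_shift)
open Literature.MathematicalPhysics.QuantumFieldTheory.Balaban1983to89.B4Lemma21Region (siteNorm dotProduct_sq_le)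

noncomputable section

variable {X : Type*} {ι : Type} [Fintype X] [Fintype ι]

/-! ## §1. The Euclidean site norm `|φ(x)|` -/

section Site

omit [Fintype X] [Fintype ι] in
/-- `fld` is additive. [folklore] -/
theorem fld_add (Φ Ψ : X × ι → ℝ) (x : X) : fld (Φ + Ψ) x = fld Φ x + fld Ψ x := rfl

omit [Fintype X] [Fintype ι] in
/-- `fld 0 = 0`. [folklore] -/
theorem fld_zero (x : X) : fld (0 : X × ι → ℝ) x = 0 := rfl

/-- `0 ≤ |v|`. [folklore] -/
theorem siteNorm_nonneg (v : ι → ℝ) : 0 ≤ siteNorm v := Real.sqrt_nonneg _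

/-- `|0| = 0`. [folklore] -/
theorem siteNorm_zero : siteNorm (0 : ι → ℝ) = 0 := by
  simp [siteNorm]

/-- `|v|² = ⟨v,v⟩`. [folklore] -/
theorem siteNorm_sq (v : ι → ℝ) : siteNorm v ^ 2 = v ⬝ᵥ v :=
  Real.sq_sqrt (dotProduct_self_nonneg' v)

/-- Cauchy–Schwarz: `|⟨u,v⟩| ≤ |u||v|`. [folklore] -/
theorem abs_dot_le (u v : ι → ℝ) : |u ⬝ᵥ v| ≤ siteNorm u * siteNorm v := by
  unfold siteNorm
  rw [← Real.sqrt_mul (dotProduct_self_nonneg' u)]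
  exact Real.abs_le_sqrt (dotProduct_sq_le u v)

/-- the triangle inequality `|u + v| ≤ |u| + |v|`. [folklore] -/
theorem siteNorm_add_le (u v : ι → ℝ) : siteNorm (u + v) ≤ siteNorm u + siteNorm v := by
  have hu := siteNorm_nonneg u
  have hv := siteNorm_nonneg v
  have h1 : (u + v) ⬝ᵥ (u + v) = u ⬝ᵥ u + 2 * (u ⬝ᵥ v) + v ⬝ᵥ v := by
    simp only [add_dotProduct, dotProduct_add, dotProduct_comm v u]; ring
  have h2 : u ⬝ᵥ v ≤ siteNorm u * siteNorm v := (le_abs_self _).trans (abs_dot_le u v)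
  have h3 : siteNorm (u + v) ^ 2 ≤ (siteNorm u + siteNorm v) ^ 2 := by
    rw [siteNorm_sq, h1, add_sq, siteNorm_sq, siteNorm_sq]
    nlinarith [h2]
  nlinarith [h3, siteNorm_nonneg (u + v), hu, hv]

/-- homogeneity `|r • v| = |r|·|v|`. [folklore] -/
theorem siteNorm_smul (r : ℝ) (v : ι → ℝ) : siteNorm (r • v) = |r| * siteNorm v := by
  unfold siteNorm
  rw [smul_dotProduct, dotProduct_smul, smul_eq_mul, smul_eq_mul, ← mul_assoc, Real.sqrt_mul' _
    (dotProduct_self_nonneg' v), Real.sqrt_mul_self_eq_abs]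

/-- a unit vector: `|(|w|⁻¹) • w| = 1` for `|w| ≠ 0`. [folklore] -/
theorem siteNorm_normalize {w : ι → ℝ} (hw : siteNorm w ≠ 0) : siteNorm ((siteNorm w)⁻¹ • w) = 1 := by
  rw [siteNorm_smul, abs_of_nonneg (inv_nonneg.2 (siteNorm_nonneg w)), inv_mul_cancel₀ hw]

/-- `⟨w, |w|⁻¹ • w⟩ = |w|`. [folklore] -/
theorem dot_normalize (w : ι → ℝ) : w ⬝ᵥ ((siteNorm w)⁻¹ • w) = siteNorm w := by
  rw [dotProduct_smul, smul_eq_mul, ← siteNorm_sq]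
  by_cases hw : siteNorm w = 0
  · rw [hw]; simp
  · field_simp

end Site

/-! ## §2. The mixed norms `‖Φ‖_∞ = sup_x |φ(x)|` and `‖Φ‖₁ = Σ_x |φ(x)|` -/

section Norms

/-- `‖Φ‖_∞ = sup_x |φ(x)|` (Euclidean norm in colour space, sup over sites; `0` for an empty site set).
[cite: Balaban1983RegularityDecay, (2.17) p. 578 (the norm ‖·‖_∞)] -/
def supN (Φ : X × ι → ℝ) : ℝ := ⨆ x : X, siteNorm (fld Φ x)

/-- `‖Φ‖₁ = Σ_x |φ(x)|` (the dual mixed norm). [folklore] -/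
def l1N (Φ : X × ι → ℝ) : ℝ := ∑ x, siteNorm (fld Φ x)

/-- `|φ(x)| ≤ ‖Φ‖_∞`. [folklore] -/
theorem le_supN (Φ : X × ι → ℝ) (x : X) : siteNorm (fld Φ x) ≤ supN Φ :=
  le_ciSup (f := fun x : X => siteNorm (fld Φ x)) (Set.finite_range _).bddAbove x

omit [Fintype X] in
/-- `‖Φ‖_∞ ≤ b` from sitewise bounds (`b ≥ 0`). [folklore] -/
theorem supN_le {Φ : X × ι → ℝ} {b : ℝ} (hb : 0 ≤ b) (h : ∀ x, siteNorm (fld Φ x) ≤ b) : supN Φ ≤ b := by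
  rcases isEmpty_or_nonempty X with hX | hX
  · simp only [supN, Real.iSup_of_isEmpty]; exact hb
  · exact ciSup_le h

/-- `0 ≤ ‖Φ‖_∞`. [folklore] -/
theorem supN_nonneg (Φ : X × ι → ℝ) : 0 ≤ supN Φ := by
  rcases isEmpty_or_nonempty X with hX | hX
  · simp only [supN, Real.iSup_of_isEmpty]; exact le_rfl
  · exact (siteNorm_nonneg _).trans (le_supN Φ (Classical.arbitrary X))

/-- `‖Φ + Ψ‖_∞ ≤ ‖Φ‖_∞ + ‖Ψ‖_∞`. [folklore] -/
theorem supN_add_le (Φ Ψ : X × ι → ℝ) : supN (Φ + Ψ) ≤ supN Φ + supN Ψ :=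
  supN_le (add_nonneg (supN_nonneg _) (supN_nonneg _)) fun x => by
    rw [fld_add]; exact (siteNorm_add_le _ _).trans (add_le_add (le_supN Φ x) (le_supN Ψ x))

/-- `‖0‖_∞ = 0`. [folklore] -/
theorem supN_zero : supN (0 : X × ι → ℝ) = 0 :=
  le_antisymm (supN_le le_rfl fun x => by rw [fld_zero, siteNorm_zero]) (supN_nonneg _)

/-- `0 ≤ ‖Φ‖₁`. [folklore] -/
theorem l1N_nonneg (Φ : X × ι → ℝ) : 0 ≤ l1N Φ := sum_nonneg fun _ _ => siteNorm_nonneg _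

/-- `‖Φ + Ψ‖₁ ≤ ‖Φ‖₁ + ‖Ψ‖₁`. [folklore] -/
theorem l1N_add_le (Φ Ψ : X × ι → ℝ) : l1N (Φ + Ψ) ≤ l1N Φ + l1N Ψ := by
  unfold l1N
  rw [← sum_add_distrib]
  exact sum_le_sum fun x _ => by rw [fld_add]; exact siteNorm_add_le _ _

/-- `‖0‖₁ = 0`. [folklore] -/
theorem l1N_zero : l1N (0 : X × ι → ℝ) = 0 := by
  unfold l1N
  exact sum_eq_zero fun x _ => by rw [fld_zero, siteNorm_zero]

/-- `|⟨Φ, Ψ⟩| ≤ ‖Φ‖_∞ ‖Ψ‖₁` (Hölder for the mixed norms). [folklore] -/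
theorem abs_dotProduct_le_supN_mul_l1N (Φ Ψ : X × ι → ℝ) : |Φ ⬝ᵥ Ψ| ≤ supN Φ * l1N Ψ := by
  rw [dotProduct_eq_sum_fld, l1N, mul_sum]
  refine (abs_sum_le_sum_abs _ _).trans (sum_le_sum fun x _ => ?_)
  exact (abs_dot_le _ _).trans (mul_le_mul_of_nonneg_right (le_supN Φ x) (siteNorm_nonneg _))

end Norms

/-! ## §3. The reduction (2.31)/(2.33) in resolvent form: a bootstrap, for any nonnegative subadditive `ν` -/

section Bootstrap

variable {κ : Type*} [Fintype κ] (ν : (X × ι → ℝ) → ℝ)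

/-- «V_k … is a first order differential operator with small coefficients»: `ν(Vu) ≤ ε(ν u + Σ_μ ν(D_μ u))` for all
`u`, relative to the family `D_μ` («D^η_{A₀,μ}»). [cite: Balaban1983RegularityDecay, p. 581 before (2.33)] -/
def FirstOrderSmall (V : Matrix (X × ι) (X × ι) ℝ) (D : κ → Matrix (X × ι) (X × ι) ℝ) (ε : ℝ) : Prop :=
  ∀ u : X × ι → ℝ, ν (V *ᵥ u) ≤ ε * (ν u + ∑ μ, ν (D μ *ᵥ u))

variable {ν}

/-- unfolding the resolvent identity on a vector: `GΦ = G₀Φ + G₀(V(GΦ))`. [folklore] -/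
theorem resolvent_mulVec {G G₀ V : Matrix (X × ι) (X × ι) ℝ} (hres : G = G₀ + G₀ * V * G) (Φ : X × ι → ℝ) :
    G *ᵥ Φ = G₀ *ᵥ Φ + G₀ *ᵥ (V *ᵥ (G *ᵥ Φ)) := by
  conv_lhs => rw [hres]
  rw [add_mulVec, ← mulVec_mulVec, ← mulVec_mulVec]

/-- **THE REDUCTION (2.31)–(2.33), RESOLVENT FORM.**  Let `ν` be nonnegative and subadditive, `G = G₀ + G₀VG` (the
resolvent identity for `H = H₀ − V`, `G = H⁻¹`, `G₀ = H₀⁻¹`: `B4Lower18Regular.inv_sub_eq`), `D_μ` (`μ ∈ κ`,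
`m = card κ`) a finite family.  IF `ν(G₀Φ) ≤ cνΦ` and `ν(D_μG₀Φ) ≤ cνΦ` («Lemma 2.2 holds for G_k(□,A₀)», (2.17) with
`p = q = ∞`, `n = 0,1`), `V` is first-order small with constant `ε` («first order differential operator with small
coefficients») and `(m+1)cε ≤ 1/2` («for e sufficiently small»), THEN
`ν(GΦ) + Σ_μ ν(D_μGΦ) ≤ 2(m+1)c·νΦ`.  (Absorption: each of the `m+1` quantities is `≤ cνΦ + cε·S`, `S` their sum.)
[cite: Balaban1983RegularityDecay, p. 581 (2.31)–(2.33)] -/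
theorem bootstrap (hν0 : ∀ a, 0 ≤ ν a) (hνadd : ∀ a b, ν (a + b) ≤ ν a + ν b)
    {G G₀ V : Matrix (X × ι) (X × ι) ℝ} {D : κ → Matrix (X × ι) (X × ι) ℝ} {c ε : ℝ}
    (hres : G = G₀ + G₀ * V * G) (hc : 0 ≤ c)
    (h0 : ∀ Φ, ν (G₀ *ᵥ Φ) ≤ c * ν Φ) (hD : ∀ μ Φ, ν (D μ *ᵥ (G₀ *ᵥ Φ)) ≤ c * ν Φ)
    (hV : FirstOrderSmall ν V D ε) (hsm : (Fintype.card κ + 1) * c * ε ≤ 1 / 2) (Φ : X × ι → ℝ) :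
    ν (G *ᵥ Φ) + ∑ μ, ν (D μ *ᵥ (G *ᵥ Φ)) ≤ 2 * ((Fintype.card κ + 1) * c) * ν Φ := by
  have hu := resolvent_mulVec hres Φ
  set u := G *ᵥ Φ with hu_def
  set S := ν u + ∑ μ, ν (D μ *ᵥ u) with hS_def
  have hS0 : 0 ≤ S := add_nonneg (hν0 _) (sum_nonneg fun μ _ => hν0 _)
  have hVu : ν (V *ᵥ u) ≤ ε * S := hV u
  have h1 : ν u ≤ c * ν Φ + c * (ε * S) :=
    calc ν u = ν (G₀ *ᵥ Φ + G₀ *ᵥ (V *ᵥ u)) := by rw [← hu]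
      _ ≤ ν (G₀ *ᵥ Φ) + ν (G₀ *ᵥ (V *ᵥ u)) := hνadd _ _
      _ ≤ c * ν Φ + c * ν (V *ᵥ u) := add_le_add (h0 Φ) (h0 _)
      _ ≤ c * ν Φ + c * (ε * S) := add_le_add le_rfl (mul_le_mul_of_nonneg_left hVu hc)
  have h2 : ∀ μ, ν (D μ *ᵥ u) ≤ c * ν Φ + c * (ε * S) := by
    intro μ
    have hDu : D μ *ᵥ u = D μ *ᵥ (G₀ *ᵥ Φ) + D μ *ᵥ (G₀ *ᵥ (V *ᵥ u)) := by
      conv_lhs => rw [hu]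
      rw [mulVec_add]
    calc ν (D μ *ᵥ u) = ν (D μ *ᵥ (G₀ *ᵥ Φ) + D μ *ᵥ (G₀ *ᵥ (V *ᵥ u))) := by rw [← hDu]
      _ ≤ ν (D μ *ᵥ (G₀ *ᵥ Φ)) + ν (D μ *ᵥ (G₀ *ᵥ (V *ᵥ u))) := hνadd _ _
      _ ≤ c * ν Φ + c * ν (V *ᵥ u) := add_le_add (hD μ Φ) (hD μ _)
      _ ≤ c * ν Φ + c * (ε * S) := add_le_add le_rfl (mul_le_mul_of_nonneg_left hVu hc)
  have h3 : S ≤ (Fintype.card κ + 1) * (c * ν Φ) + (Fintype.card κ + 1) * c * ε * S := by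
    have hsum : ∑ μ, ν (D μ *ᵥ u) ≤ ∑ _μ : κ, (c * ν Φ + c * (ε * S)) := sum_le_sum fun μ _ => h2 μ
    rw [sum_const, card_univ, nsmul_eq_mul] at hsum
    calc S = ν u + ∑ μ, ν (D μ *ᵥ u) := rfl
      _ ≤ (c * ν Φ + c * (ε * S)) + Fintype.card κ * (c * ν Φ + c * (ε * S)) := add_le_add h1 hsum
      _ = _ := by ring
  have h4 : (Fintype.card κ + 1 : ℝ) * c * ε * S ≤ 1 / 2 * S := mul_le_mul_of_nonneg_right hsm hS0
  have hcν : 0 ≤ (Fintype.card κ + 1 : ℝ) * (c * ν Φ) := by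
    have := hν0 Φ; positivity
  nlinarith [h3, h4, hcν, hS0]

/-- the bound for `G_k(□,Ã)` itself: `ν(GΦ) ≤ 2(m+1)c·νΦ`. [cite: Balaban1983RegularityDecay, p. 581 (2.33)] -/
theorem bootstrap_green (hν0 : ∀ a, 0 ≤ ν a) (hνadd : ∀ a b, ν (a + b) ≤ ν a + ν b)
    {G G₀ V : Matrix (X × ι) (X × ι) ℝ} {D : κ → Matrix (X × ι) (X × ι) ℝ} {c ε : ℝ}
    (hres : G = G₀ + G₀ * V * G) (hc : 0 ≤ c)
    (h0 : ∀ Φ, ν (G₀ *ᵥ Φ) ≤ c * ν Φ) (hD : ∀ μ Φ, ν (D μ *ᵥ (G₀ *ᵥ Φ)) ≤ c * ν Φ)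
    (hV : FirstOrderSmall ν V D ε) (hsm : (Fintype.card κ + 1) * c * ε ≤ 1 / 2) (Φ : X × ι → ℝ) :
    ν (G *ᵥ Φ) ≤ 2 * ((Fintype.card κ + 1) * c) * ν Φ :=
  le_trans (le_add_of_nonneg_right (sum_nonneg fun _ _ => hν0 _))
    (bootstrap hν0 hνadd hres hc h0 hD hV hsm Φ)

/-- the bound for `D^η_{A₀,μ}G_k(□,Ã)`: `ν(D_μGΦ) ≤ 2(m+1)c·νΦ`. [cite: Balaban1983RegularityDecay, p. 581 (2.33)] -/
theorem bootstrap_deriv (hν0 : ∀ a, 0 ≤ ν a) (hνadd : ∀ a b, ν (a + b) ≤ ν a + ν b)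
    {G G₀ V : Matrix (X × ι) (X × ι) ℝ} {D : κ → Matrix (X × ι) (X × ι) ℝ} {c ε : ℝ}
    (hres : G = G₀ + G₀ * V * G) (hc : 0 ≤ c)
    (h0 : ∀ Φ, ν (G₀ *ᵥ Φ) ≤ c * ν Φ) (hD : ∀ μ Φ, ν (D μ *ᵥ (G₀ *ᵥ Φ)) ≤ c * ν Φ)
    (hV : FirstOrderSmall ν V D ε) (hsm : (Fintype.card κ + 1) * c * ε ≤ 1 / 2) (μ : κ) (Φ : X × ι → ℝ) :
    ν (D μ *ᵥ (G *ᵥ Φ)) ≤ 2 * ((Fintype.card κ + 1) * c) * ν Φ := by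
  refine le_trans ?_ (bootstrap hν0 hνadd hres hc h0 hD hV hsm Φ)
  refine le_trans ?_ (le_add_of_nonneg_left (hν0 _))
  exact single_le_sum (f := fun μ => ν (D μ *ᵥ (G *ᵥ Φ))) (fun μ _ => hν0 _) (mem_univ μ)

/-- the perturbation of `u = GΦ` is small: `ν(V(GΦ)) ≤ ε·2(m+1)c·νΦ ≤ νΦ`. [folklore] -/
theorem bootstrap_pert (hν0 : ∀ a, 0 ≤ ν a) (hνadd : ∀ a b, ν (a + b) ≤ ν a + ν b)
    {G G₀ V : Matrix (X × ι) (X × ι) ℝ} {D : κ → Matrix (X × ι) (X × ι) ℝ} {c ε : ℝ}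
    (hres : G = G₀ + G₀ * V * G) (hc : 0 ≤ c) (hε : 0 ≤ ε)
    (h0 : ∀ Φ, ν (G₀ *ᵥ Φ) ≤ c * ν Φ) (hD : ∀ μ Φ, ν (D μ *ᵥ (G₀ *ᵥ Φ)) ≤ c * ν Φ)
    (hV : FirstOrderSmall ν V D ε) (hsm : (Fintype.card κ + 1) * c * ε ≤ 1 / 2) (Φ : X × ι → ℝ) :
    ν (V *ᵥ (G *ᵥ Φ)) ≤ ν Φ := by
  have h := mul_le_mul_of_nonneg_left (bootstrap hν0 hνadd hres hc h0 hD hV hsm Φ) hε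
  refine (hV _).trans (h.trans ?_)
  have hΦ := hν0 Φ
  calc ε * (2 * ((Fintype.card κ + 1) * c) * ν Φ) = 2 * ((Fintype.card κ + 1) * c * ε) * ν Φ := by ring
    _ ≤ 2 * (1 / 2) * ν Φ := by gcongr
    _ = ν Φ := by ring

omit [Fintype X] [Fintype ι] [Fintype κ] in
/-- `ν(Σ_μ f_μ) ≤ Σ_μ ν(f_μ)` for a subadditive `ν` with `ν 0 ≤ 0`. [folklore] -/
theorem nu_sum_le {σ : Type*} (hν00 : ν 0 ≤ 0) (hνadd : ∀ a b, ν (a + b) ≤ ν a + ν b) (s : Finset σ)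
    (f : σ → X × ι → ℝ) : ν (∑ μ ∈ s, f μ) ≤ ∑ μ ∈ s, ν (f μ) := by
  classical
  induction s using Finset.induction_on with
  | empty => simpa using hν00
  | insert a s ha ih =>
      rw [sum_insert ha, sum_insert ha]
      exact (hνadd _ _).trans (add_le_add le_rfl ih)

/-- **THE SHAPE OF (2.32)**: an operator `V = E₀ + Σ_μ E_μD_μ` whose coefficients `E₀, E_μ` are `ν`-bounded by `ε`
(«first order differential operator with small coefficients») is first-order small relative to `(D_μ)` with
constant `ε`. [cite: Balaban1983RegularityDecay, p. 581 (2.32)] -/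
theorem firstOrderSmall_of_decomp (hν00 : ν 0 ≤ 0) (hνadd : ∀ a b, ν (a + b) ≤ ν a + ν b)
    {V E₀ : Matrix (X × ι) (X × ι) ℝ} {E D : κ → Matrix (X × ι) (X × ι) ℝ} {ε : ℝ}
    (hVdec : V = E₀ + ∑ μ, E μ * D μ) (hE₀ : ∀ u, ν (E₀ *ᵥ u) ≤ ε * ν u)
    (hE : ∀ μ w, ν (E μ *ᵥ w) ≤ ε * ν w) : FirstOrderSmall ν V D ε := by
  intro u
  rw [hVdec, add_mulVec, sum_mulVec]
  calc ν (E₀ *ᵥ u + ∑ μ, (E μ * D μ) *ᵥ u) ≤ ν (E₀ *ᵥ u) + ν (∑ μ, (E μ * D μ) *ᵥ u) := hνadd _ _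
    _ ≤ ε * ν u + ∑ μ, ν ((E μ * D μ) *ᵥ u) := add_le_add (hE₀ u) (nu_sum_le hν00 hνadd _ _)
    _ ≤ ε * ν u + ∑ μ, ε * ν (D μ *ᵥ u) :=
        add_le_add le_rfl (sum_le_sum fun μ _ => by rw [← mulVec_mulVec]; exact hE μ _)
    _ = ε * (ν u + ∑ μ, ν (D μ *ᵥ u)) := by rw [← mul_sum, mul_add]

end Bootstrap

/-! ## §4. The transfer (2.33) to «stronger norms» -/

section Transfer

variable {κ : Type*} [Fintype κ] {ν : (X × ι → ℝ) → ℝ}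

/-- **(2.33), THE TRANSFER TO A STRONGER NORM `N`** (in [B4]: `N = ‖·‖_{1,α}`, the `A₀`-bound being (2.16) for
`G_k(□,A₀)`; or `N` an `L^q` norm for (2.17)): if `N` is subadditive and `N(G₀Φ) ≤ c₁·νΦ` for all `Φ`, then under the
hypotheses of `bootstrap` `N(GΦ) ≤ 2c₁·νΦ` — «(2.33) ‖G_k(□,Ã)f‖_{1,α} ≤ O(1)c₁ Σ_{n=0}^∞ ‖(V_kG_k(□,A₀))^nf‖_∞ ≤
O(1)c₁ Σ_{n=0}^∞ (O(1)e^βc₂)^n‖f‖_∞. The series on the right hand side is convergent for e sufficiently small, and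
we get the inequality (2.16).» [cite: Balaban1983RegularityDecay, p. 581 (2.33)] -/
theorem transfer (hν0 : ∀ a, 0 ≤ ν a) (hνadd : ∀ a b, ν (a + b) ≤ ν a + ν b)
    {G G₀ V : Matrix (X × ι) (X × ι) ℝ} {D : κ → Matrix (X × ι) (X × ι) ℝ} {c ε : ℝ}
    (hres : G = G₀ + G₀ * V * G) (hc : 0 ≤ c) (hε : 0 ≤ ε)
    (h0 : ∀ Φ, ν (G₀ *ᵥ Φ) ≤ c * ν Φ) (hD : ∀ μ Φ, ν (D μ *ᵥ (G₀ *ᵥ Φ)) ≤ c * ν Φ)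
    (hV : FirstOrderSmall ν V D ε) (hsm : (Fintype.card κ + 1) * c * ε ≤ 1 / 2)
    {N : (X × ι → ℝ) → ℝ} (hNadd : ∀ a b, N (a + b) ≤ N a + N b) {c₁ : ℝ} (hc₁ : 0 ≤ c₁)
    (hN0 : ∀ Φ, N (G₀ *ᵥ Φ) ≤ c₁ * ν Φ) (Φ : X × ι → ℝ) :
    N (G *ᵥ Φ) ≤ 2 * c₁ * ν Φ := by
  have hp := bootstrap_pert hν0 hνadd hres hc hε h0 hD hV hsm Φ
  calc N (G *ᵥ Φ) = N (G₀ *ᵥ Φ + G₀ *ᵥ (V *ᵥ (G *ᵥ Φ))) := by rw [← resolvent_mulVec hres]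
    _ ≤ N (G₀ *ᵥ Φ) + N (G₀ *ᵥ (V *ᵥ (G *ᵥ Φ))) := hNadd _ _
    _ ≤ c₁ * ν Φ + c₁ * ν (V *ᵥ (G *ᵥ Φ)) := add_le_add (hN0 _) (hN0 _)
    _ ≤ c₁ * ν Φ + c₁ * ν Φ := add_le_add le_rfl (mul_le_mul_of_nonneg_left hp hc₁)
    _ = 2 * c₁ * ν Φ := by ring

end Transfer

/-! ## §5. The literal Neumann form (2.31)/(2.33): geometric bounds for the terms `G₀(VG₀)^n` -/

section Neumann

variable [DecidableEq X] [DecidableEq ι] {κ : Type*} [Fintype κ] {ν : (X × ι → ℝ) → ℝ}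

omit [DecidableEq X] [DecidableEq ι] in
/-- one Neumann step: `ν(VG₀g) ≤ θ·νg` with `θ = ε(m+1)c` — the printed ratio «O(1)e^βc₂».
[cite: Balaban1983RegularityDecay, p. 581 (2.33)] -/
theorem neumannStep {G₀ V : Matrix (X × ι) (X × ι) ℝ} {D : κ → Matrix (X × ι) (X × ι) ℝ}
    {c ε : ℝ} (hε : 0 ≤ ε) (h0 : ∀ Φ, ν (G₀ *ᵥ Φ) ≤ c * ν Φ) (hD : ∀ μ Φ, ν (D μ *ᵥ (G₀ *ᵥ Φ)) ≤ c * ν Φ)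
    (hV : FirstOrderSmall ν V D ε) (g : X × ι → ℝ) :
    ν (V *ᵥ (G₀ *ᵥ g)) ≤ ε * ((Fintype.card κ + 1) * c) * ν g := by
  refine (hV _).trans ?_
  have hsum : ∑ μ, ν (D μ *ᵥ (G₀ *ᵥ g)) ≤ ∑ _μ : κ, c * ν g := sum_le_sum fun μ _ => hD μ g
  rw [sum_const, card_univ, nsmul_eq_mul] at hsum
  have := add_le_add (h0 g) hsum
  calc ε * (ν (G₀ *ᵥ g) + ∑ μ, ν (D μ *ᵥ (G₀ *ᵥ g))) ≤ ε * (c * ν g + Fintype.card κ * (c * ν g)) :=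
        mul_le_mul_of_nonneg_left this hε
    _ = ε * ((Fintype.card κ + 1) * c) * ν g := by ring

/-- `n` Neumann steps: `ν((VG₀)^n g) ≤ θ^n·νg`. [cite: Balaban1983RegularityDecay, p. 581 (2.31), (2.33)] -/
theorem neumannPow {G₀ V : Matrix (X × ι) (X × ι) ℝ} {D : κ → Matrix (X × ι) (X × ι) ℝ}
    {c ε : ℝ} (hε : 0 ≤ ε) (hc : 0 ≤ c) (h0 : ∀ Φ, ν (G₀ *ᵥ Φ) ≤ c * ν Φ)
    (hD : ∀ μ Φ, ν (D μ *ᵥ (G₀ *ᵥ Φ)) ≤ c * ν Φ) (hV : FirstOrderSmall ν V D ε) (n : ℕ) (g : X × ι → ℝ) :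
    ν (((V * G₀) ^ n) *ᵥ g) ≤ (ε * ((Fintype.card κ + 1) * c)) ^ n * ν g := by
  induction n generalizing g with
  | zero => simp
  | succ n ih =>
      rw [pow_succ, ← mulVec_mulVec, ← mulVec_mulVec]
      have hθ : 0 ≤ ε * ((Fintype.card κ + 1) * c) := by positivity
      calc ν ((V * G₀) ^ n *ᵥ (V *ᵥ (G₀ *ᵥ g))) ≤ (ε * ((Fintype.card κ + 1) * c)) ^ n * ν (V *ᵥ (G₀ *ᵥ g)) :=
            ih _
        _ ≤ (ε * ((Fintype.card κ + 1) * c)) ^ n * (ε * ((Fintype.card κ + 1) * c) * ν g) :=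
            mul_le_mul_of_nonneg_left (neumannStep hε h0 hD hV g) (pow_nonneg hθ n)
        _ = _ := by ring

/-- **THE PARTIAL SUMS OF (2.31) IN A STRONGER NORM**: `N(Σ_{n<K} G₀(VG₀)^n f) ≤ c₁(Σ_{n<K} θ^n)·νf` for a
subadditive `N` with `N 0 ≤ 0` and `N(G₀Φ) ≤ c₁νΦ` — the middle expression of (2.33).
[cite: Balaban1983RegularityDecay, p. 581 (2.31), (2.33)] -/
theorem partialSum_le {G₀ V : Matrix (X × ι) (X × ι) ℝ} {D : κ → Matrix (X × ι) (X × ι) ℝ}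
    {c ε : ℝ} (hε : 0 ≤ ε) (hc : 0 ≤ c) (h0 : ∀ Φ, ν (G₀ *ᵥ Φ) ≤ c * ν Φ)
    (hD : ∀ μ Φ, ν (D μ *ᵥ (G₀ *ᵥ Φ)) ≤ c * ν Φ) (hV : FirstOrderSmall ν V D ε)
    {N : (X × ι → ℝ) → ℝ} (hNadd : ∀ a b, N (a + b) ≤ N a + N b) (hN00 : N 0 ≤ 0) {c₁ : ℝ} (hc₁ : 0 ≤ c₁)
    (hN0 : ∀ Φ, N (G₀ *ᵥ Φ) ≤ c₁ * ν Φ) (K : ℕ) (f : X × ι → ℝ) :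
    N ((∑ n ∈ range K, G₀ * (V * G₀) ^ n) *ᵥ f)
      ≤ c₁ * (∑ n ∈ range K, (ε * ((Fintype.card κ + 1) * c)) ^ n) * ν f := by
  induction K with
  | zero => simpa using hN00
  | succ K ih =>
      rw [sum_range_succ, sum_range_succ, add_mulVec, ← mulVec_mulVec]
      refine (hNadd _ _).trans ?_
      have h2 : N (G₀ *ᵥ ((V * G₀) ^ K *ᵥ f)) ≤ c₁ * ((ε * ((Fintype.card κ + 1) * c)) ^ K * ν f) :=
        (hN0 _).trans (mul_le_mul_of_nonneg_left (neumannPow hε hc h0 hD hV K f) hc₁)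
      calc _ ≤ c₁ * (∑ n ∈ range K, (ε * ((Fintype.card κ + 1) * c)) ^ n) * ν f
            + c₁ * ((ε * ((Fintype.card κ + 1) * c)) ^ K * ν f) := add_le_add ih h2
        _ = _ := by ring

/-- … `≤ c₁/(1−θ)·νf` for `θ < 1` — «The series on the right hand side is convergent for e sufficiently small».
[cite: Balaban1983RegularityDecay, p. 581 (2.33)] -/
theorem partialSum_le_geom (hν0 : ∀ a, 0 ≤ ν a) {G₀ V : Matrix (X × ι) (X × ι) ℝ}
    {D : κ → Matrix (X × ι) (X × ι) ℝ} {c ε : ℝ} (hε : 0 ≤ ε) (hc : 0 ≤ c)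
    (h0 : ∀ Φ, ν (G₀ *ᵥ Φ) ≤ c * ν Φ) (hD : ∀ μ Φ, ν (D μ *ᵥ (G₀ *ᵥ Φ)) ≤ c * ν Φ)
    (hV : FirstOrderSmall ν V D ε) {N : (X × ι → ℝ) → ℝ} (hNadd : ∀ a b, N (a + b) ≤ N a + N b)
    (hN00 : N 0 ≤ 0) {c₁ : ℝ} (hc₁ : 0 ≤ c₁) (hN0 : ∀ Φ, N (G₀ *ᵥ Φ) ≤ c₁ * ν Φ)
    (hθ : ε * ((Fintype.card κ + 1) * c) < 1) (K : ℕ) (f : X × ι → ℝ) :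
    N ((∑ n ∈ range K, G₀ * (V * G₀) ^ n) *ᵥ f) ≤ c₁ / (1 - ε * ((Fintype.card κ + 1) * c)) * ν f := by
  refine (partialSum_le hε hc h0 hD hV hNadd hN00 hc₁ hN0 K f).trans ?_
  set θ := ε * ((Fintype.card κ + 1) * c) with hθ_def
  have hθ0 : 0 ≤ θ := by positivity
  have hθ1 : 0 < 1 - θ := sub_pos.2 hθ
  have hgeom : ∑ n ∈ range K, θ ^ n ≤ 1 / (1 - θ) := by
    rw [le_div_iff₀ hθ1, geom_sum_mul_neg]
    linarith [pow_nonneg hθ0 K]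
  have hf := hν0 f
  calc c₁ * (∑ n ∈ range K, θ ^ n) * ν f ≤ c₁ * (1 / (1 - θ)) * ν f := by gcongr
    _ = c₁ / (1 - θ) * ν f := by ring

omit [Fintype κ] in
/-- **(2.31) TO ORDER `K` WITH REMAINDER, IN THE PRINTED ORDERING**:
`G = Σ_{n<K} G₀(VG₀)^n + (G₀V)^K G` for `H = H₀ − V` (`B4Lower18Regular.inv_sub_expand` + `pow_mul_shift`).
[cite: Balaban1983RegularityDecay, p. 581 (2.31)] -/
theorem expansion231 {H₀ V : Matrix (X × ι) (X × ι) ℝ} (hH₀ : IsUnit H₀.det) (hH : IsUnit (H₀ - V).det)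
    (K : ℕ) : (H₀ - V)⁻¹ = ∑ n ∈ range K, H₀⁻¹ * (V * H₀⁻¹) ^ n + (H₀⁻¹ * V) ^ K * (H₀ - V)⁻¹ := by
  refine (inv_sub_expand hH₀ hH K).trans ?_
  congr 1
  exact sum_congr rfl fun n _ => pow_mul_shift _ _ n

omit [Fintype κ] in
/-- `(G₀V)^{K+1} = G₀(VG₀)^K V`. [folklore] -/
theorem pow_succ_shift (G₀ V : Matrix (X × ι) (X × ι) ℝ) (K : ℕ) :
    (G₀ * V) ^ (K + 1) = G₀ * (V * G₀) ^ K * V := by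
  rw [pow_succ, ← Matrix.mul_assoc, pow_mul_shift]

/-- **THE REMAINDER OF (2.31) IS GEOMETRICALLY SMALL**: under the hypotheses of `bootstrap`,
`ν((G₀V)^{K+1}G f) ≤ c·θ^K·νf` — so the partial sums of (2.31) converge to `G` in every such `ν`
(«convergent in stronger norms»). [cite: Balaban1983RegularityDecay, p. 581 (2.31)–(2.33)] -/
theorem remainder_le (hν0 : ∀ a, 0 ≤ ν a) (hνadd : ∀ a b, ν (a + b) ≤ ν a + ν b)
    {G G₀ V : Matrix (X × ι) (X × ι) ℝ} {D : κ → Matrix (X × ι) (X × ι) ℝ} {c ε : ℝ}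
    (hres : G = G₀ + G₀ * V * G) (hc : 0 ≤ c) (hε : 0 ≤ ε)
    (h0 : ∀ Φ, ν (G₀ *ᵥ Φ) ≤ c * ν Φ) (hD : ∀ μ Φ, ν (D μ *ᵥ (G₀ *ᵥ Φ)) ≤ c * ν Φ)
    (hV : FirstOrderSmall ν V D ε) (hsm : (Fintype.card κ + 1) * c * ε ≤ 1 / 2) (K : ℕ) (f : X × ι → ℝ) :
    ν (((G₀ * V) ^ (K + 1) * G) *ᵥ f) ≤ c * (ε * ((Fintype.card κ + 1) * c)) ^ K * ν f := by
  rw [pow_succ_shift, ← mulVec_mulVec, ← mulVec_mulVec, ← mulVec_mulVec]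
  have hθ : 0 ≤ ε * ((Fintype.card κ + 1) * c) := by positivity
  have hp := bootstrap_pert hν0 hνadd hres hc hε h0 hD hV hsm f
  calc ν (G₀ *ᵥ ((V * G₀) ^ K *ᵥ (V *ᵥ (G *ᵥ f)))) ≤ c * ν ((V * G₀) ^ K *ᵥ (V *ᵥ (G *ᵥ f))) := h0 _
    _ ≤ c * ((ε * ((Fintype.card κ + 1) * c)) ^ K * ν (V *ᵥ (G *ᵥ f))) :=
        mul_le_mul_of_nonneg_left (neumannPow hε hc h0 hD hV K _) hc
    _ ≤ c * ((ε * ((Fintype.card κ + 1) * c)) ^ K * ν f) :=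
        mul_le_mul_of_nonneg_left (mul_le_mul_of_nonneg_left hp (pow_nonneg hθ K)) hc
    _ = _ := by ring

end Neumann

/-! ## §6. «the decomposition D^η_Ã = U(A')D^η_{A₀} + F_{1,k}(A')»: converting the derivative family -/

section Convert

variable {κ : Type*} [Fintype κ] {ν : (X × ι → ℝ) → ℝ}

/-- **THE BOUND FOR `D^η_{Ã,μ}G_k(□,Ã)`**: if `D'_μ − D_μ` is first-order small relative to `(D_ν)` with constant
`φ` («D^η_Ã = U(A')D^η_{A₀} + F_{1,k}(A')» with `|U(A') − 1|`, `F_{1,k}` small), then under the hypotheses of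
`bootstrap` `ν(D'_μGΦ) ≤ (1+φ)·2(m+1)c·νΦ`. [cite: Balaban1983RegularityDecay, p. 581 before (2.33)] -/
theorem deriv_convert (hν0 : ∀ a, 0 ≤ ν a) (hνadd : ∀ a b, ν (a + b) ≤ ν a + ν b)
    {G G₀ V : Matrix (X × ι) (X × ι) ℝ} {D D' : κ → Matrix (X × ι) (X × ι) ℝ} {c ε φ : ℝ}
    (hres : G = G₀ + G₀ * V * G) (hc : 0 ≤ c)
    (h0 : ∀ Φ, ν (G₀ *ᵥ Φ) ≤ c * ν Φ) (hD : ∀ μ Φ, ν (D μ *ᵥ (G₀ *ᵥ Φ)) ≤ c * ν Φ)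
    (hV : FirstOrderSmall ν V D ε) (hsm : (Fintype.card κ + 1) * c * ε ≤ 1 / 2) (hφ : 0 ≤ φ)
    (hD' : ∀ μ u, ν ((D' μ - D μ) *ᵥ u) ≤ φ * (ν u + ∑ ν', ν (D ν' *ᵥ u))) (μ : κ) (Φ : X × ι → ℝ) :
    ν (D' μ *ᵥ (G *ᵥ Φ)) ≤ (1 + φ) * (2 * ((Fintype.card κ + 1) * c)) * ν Φ := by
  have hS := bootstrap hν0 hνadd hres hc h0 hD hV hsm Φ
  have hμ : ν (D μ *ᵥ (G *ᵥ Φ)) ≤ 2 * ((Fintype.card κ + 1) * c) * ν Φ :=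
    bootstrap_deriv hν0 hνadd hres hc h0 hD hV hsm μ Φ
  have hsplit : D' μ *ᵥ (G *ᵥ Φ) = D μ *ᵥ (G *ᵥ Φ) + (D' μ - D μ) *ᵥ (G *ᵥ Φ) := by
    rw [sub_mulVec]; abel
  calc ν (D' μ *ᵥ (G *ᵥ Φ)) = ν (D μ *ᵥ (G *ᵥ Φ) + (D' μ - D μ) *ᵥ (G *ᵥ Φ)) := by rw [← hsplit]
    _ ≤ ν (D μ *ᵥ (G *ᵥ Φ)) + ν ((D' μ - D μ) *ᵥ (G *ᵥ Φ)) := hνadd _ _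
    _ ≤ 2 * ((Fintype.card κ + 1) * c) * ν Φ + φ * (2 * ((Fintype.card κ + 1) * c) * ν Φ) :=
        add_le_add hμ ((hD' μ _).trans (mul_le_mul_of_nonneg_left hS hφ))
    _ = (1 + φ) * (2 * ((Fintype.card κ + 1) * c)) * ν Φ := by ring

end Convert

/-! ## §7. «(2.17) is proved in the same way»: the clause `G D^{η*}_μ` by `ℓ¹`–`ℓ^∞` duality -/

section Duality

/-- **DUALITY OF THE MIXED NORMS**: an `ℓ¹` bound `‖TΦ‖₁ ≤ B‖Φ‖₁` for `T` gives the sup bound `‖Tᵀg‖_∞ ≤ B‖g‖_∞`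
for the transpose (test `Tᵀg` at a site `x` against the unit field supported at `x`). [folklore] -/
theorem supN_transpose_le {T : Matrix (X × ι) (X × ι) ℝ} {B : ℝ} (hB : 0 ≤ B)
    (h : ∀ Φ : X × ι → ℝ, l1N (T *ᵥ Φ) ≤ B * l1N Φ) (g : X × ι → ℝ) : supN (Tᵀ *ᵥ g) ≤ B * supN g := by
  classical
  refine supN_le (mul_nonneg hB (supN_nonneg g)) fun x => ?_
  set w : ι → ℝ := fld (Tᵀ *ᵥ g) x with hw_def
  by_cases hw : siteNorm w = 0
  · rw [hw]; exact mul_nonneg hB (supN_nonneg g)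
  -- the unit test field supported at `x`
  let tf : X × ι → ℝ := fun p => if p.1 = x then (siteNorm w)⁻¹ * w p.2 else 0
  have hfld : ∀ x', fld tf x' = if x' = x then (siteNorm w)⁻¹ • w else 0 := by
    intro x'
    funext i
    by_cases hx : x' = x
    · simp [tf, fld_apply, hx]
    · simp [tf, fld_apply, hx]
  have hl1 : l1N tf = 1 := by
    unfold l1N
    rw [sum_eq_single x (fun x' _ hx' => by rw [hfld, if_neg hx', siteNorm_zero]) (fun hx => absurd (mem_univ x) hx),
      hfld, if_pos rfl, siteNorm_normalize hw]
  have hpair : (Tᵀ *ᵥ g) ⬝ᵥ tf = siteNorm w := by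
    rw [dotProduct_eq_sum_fld, sum_eq_single x (fun x' _ hx' => by rw [hfld, if_neg hx', dotProduct_zero])
      (fun hx => absurd (mem_univ x) hx), hfld, if_pos rfl, ← hw_def, dot_normalize]
  have hdual : (Tᵀ *ᵥ g) ⬝ᵥ tf = g ⬝ᵥ (T *ᵥ tf) := by
    rw [mulVec_transpose, dotProduct_mulVec]
  calc siteNorm w = g ⬝ᵥ (T *ᵥ tf) := by rw [← hdual, hpair]
    _ ≤ |g ⬝ᵥ (T *ᵥ tf)| := le_abs_self _
    _ ≤ supN g * l1N (T *ᵥ tf) := abs_dotProduct_le_supN_mul_l1N _ _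
    _ ≤ supN g * (B * l1N tf) := mul_le_mul_of_nonneg_left (h _) (supN_nonneg g)
    _ = B * supN g := by rw [hl1, mul_one, mul_comm]

variable {κ : Type*} [Fintype κ]

/-- **THE CLAUSE `G_k(□,Ã)D^{η*}_{Ã,μ}` OF (2.17) AT `q = ∞`**: for symmetric `G` (`Gᵀ = G`), the `ℓ¹` instance of
`bootstrap` for `D_μG` gives, by duality, `‖G D_μᵀ f‖_∞ ≤ 2(m+1)c‖f‖_∞` (`G D_μᵀ = (D_μG)ᵀ`).
[cite: Balaban1983RegularityDecay, p. 581 «The inequality (2.17) is proved in the same way»] -/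
theorem bootstrap_dual {G G₀ V : Matrix (X × ι) (X × ι) ℝ} {D : κ → Matrix (X × ι) (X × ι) ℝ} {c ε : ℝ}
    (hres : G = G₀ + G₀ * V * G) (hGt : Gᵀ = G) (hc : 0 ≤ c)
    (h0 : ∀ Φ, l1N (G₀ *ᵥ Φ) ≤ c * l1N Φ) (hD : ∀ μ Φ, l1N (D μ *ᵥ (G₀ *ᵥ Φ)) ≤ c * l1N Φ)
    (hV : FirstOrderSmall l1N V D ε) (hsm : (Fintype.card κ + 1) * c * ε ≤ 1 / 2) (μ : κ) (f : X × ι → ℝ) :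
    supN ((G * (D μ)ᵀ) *ᵥ f) ≤ 2 * ((Fintype.card κ + 1) * c) * supN f := by
  have hT : G * (D μ)ᵀ = (D μ * G)ᵀ := by rw [transpose_mul, hGt]
  rw [hT]
  refine supN_transpose_le (by positivity) (fun Φ => ?_) f
  rw [← mulVec_mulVec]
  exact bootstrap_deriv l1N_nonneg l1N_add_le hres hc h0 hD hV hsm μ Φ

end Duality

/-! ## §8. The sup-norm instance ((2.17) at `p = q = ∞`) and a toy model of the hypotheses -/

section Instances

variable [DecidableEq X] [DecidableEq ι] {κ : Type*} [Fintype κ]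

omit [DecidableEq X] [DecidableEq ι] in
/-- **(2.17) AT `p = q = ∞` FOR `G_k(□,Ã)`, CLAUSES `n = 0, 1`, FROM THE SAME FOR `G_k(□,A₀)`** (the `supN` instance
of `bootstrap`): `‖GΦ‖_∞ + Σ_μ ‖D_μGΦ‖_∞ ≤ 2(m+1)c‖Φ‖_∞`. [cite: Balaban1983RegularityDecay, p. 581 (2.31)–(2.33),
(2.17) p. 578] -/
theorem reduce_sup {G G₀ V : Matrix (X × ι) (X × ι) ℝ} {D : κ → Matrix (X × ι) (X × ι) ℝ} {c ε : ℝ}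
    (hres : G = G₀ + G₀ * V * G) (hc : 0 ≤ c)
    (h0 : ∀ Φ, supN (G₀ *ᵥ Φ) ≤ c * supN Φ) (hD : ∀ μ Φ, supN (D μ *ᵥ (G₀ *ᵥ Φ)) ≤ c * supN Φ)
    (hV : FirstOrderSmall supN V D ε) (hsm : (Fintype.card κ + 1) * c * ε ≤ 1 / 2) (Φ : X × ι → ℝ) :
    supN (G *ᵥ Φ) + ∑ μ, supN (D μ *ᵥ (G *ᵥ Φ)) ≤ 2 * ((Fintype.card κ + 1) * c) * supN Φ :=
  bootstrap supN_nonneg supN_add_le hres hc h0 hD hV hsm Φ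

/-- the same packaged for the perturbed operator `H = H₀ − V` with `G = H⁻¹`, `G₀ = H₀⁻¹` (invertibility as
hypotheses; the resolvent identity is `B4Lower18Regular.inv_sub_eq`). [cite: Balaban1983RegularityDecay, p. 580
(2.26), p. 581 (2.31)–(2.33)] -/
theorem reduce_sup_inv {H₀ V : Matrix (X × ι) (X × ι) ℝ} {D : κ → Matrix (X × ι) (X × ι) ℝ} {c ε : ℝ}
    (hH₀ : IsUnit H₀.det) (hH : IsUnit (H₀ - V).det) (hc : 0 ≤ c)
    (h0 : ∀ Φ, supN (H₀⁻¹ *ᵥ Φ) ≤ c * supN Φ) (hD : ∀ μ Φ, supN (D μ *ᵥ (H₀⁻¹ *ᵥ Φ)) ≤ c * supN Φ)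
    (hV : FirstOrderSmall supN V D ε) (hsm : (Fintype.card κ + 1) * c * ε ≤ 1 / 2) (Φ : X × ι → ℝ) :
    supN ((H₀ - V)⁻¹ *ᵥ Φ) + ∑ μ, supN (D μ *ᵥ ((H₀ - V)⁻¹ *ᵥ Φ))
      ≤ 2 * ((Fintype.card κ + 1) * c) * supN Φ :=
  reduce_sup (inv_sub_eq hH₀ hH) hc h0 hD hV hsm Φ

omit [DecidableEq X] [DecidableEq ι] in
/-- the `ℓ¹` instance of `bootstrap` (dual norm; feeds `bootstrap_dual`): `‖GΦ‖₁ + Σ_μ ‖D_μGΦ‖₁ ≤ 2(m+1)c‖Φ‖₁`.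
[cite: Balaban1983RegularityDecay, p. 581 (2.31)–(2.33)] -/
theorem reduce_l1 {G G₀ V : Matrix (X × ι) (X × ι) ℝ} {D : κ → Matrix (X × ι) (X × ι) ℝ} {c ε : ℝ}
    (hres : G = G₀ + G₀ * V * G) (hc : 0 ≤ c)
    (h0 : ∀ Φ, l1N (G₀ *ᵥ Φ) ≤ c * l1N Φ) (hD : ∀ μ Φ, l1N (D μ *ᵥ (G₀ *ᵥ Φ)) ≤ c * l1N Φ)
    (hV : FirstOrderSmall l1N V D ε) (hsm : (Fintype.card κ + 1) * c * ε ≤ 1 / 2) (Φ : X × ι → ℝ) :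
    l1N (G *ᵥ Φ) + ∑ μ, l1N (D μ *ᵥ (G *ᵥ Φ)) ≤ 2 * ((Fintype.card κ + 1) * c) * l1N Φ :=
  bootstrap l1N_nonneg l1N_add_le hres hc h0 hD hV hsm Φ

/-- on a one-point site set with one colour, `‖Φ‖_∞ = |Φ(⋆,⋆)|`. [folklore] -/
theorem supN_unit (Φ : Unit × Unit → ℝ) : supN Φ = |Φ ((), ())| := by
  have h1 : ∀ x : Unit, siteNorm (fld Φ x) = |Φ ((), ())| := by
    intro x
    unfold siteNorm
    rw [show fld Φ x ⬝ᵥ fld Φ x = Φ ((), ()) * Φ ((), ()) by simp [dotProduct, fld_apply],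
      Real.sqrt_mul_self_eq_abs]
  unfold supN
  simp_rw [h1]
  exact ciSup_const

/-- **TOY MODEL OF THE HYPOTHESES** (`X = ι = κ = Unit`): `H₀ = 2`, `V = 1/2 ≠ 0`, `H = 3/2`, `G₀ = 1/2`, `G = 2/3`,
`D = 1`, `c = 1/2`, `ε = 1/4`: the resolvent identity, the `A₀`-bounds, the first-order smallness and
`(m+1)cε = 1/4 ≤ 1/2` all hold, so `reduce_sup` applies (conclusion: `‖GΦ‖_∞ + ‖DGΦ‖_∞ ≤ 2‖Φ‖_∞`; indeed
`= 4/3‖Φ‖_∞`).  The hypotheses of §3 are thus jointly satisfiable with `V ≠ 0`. [folklore] -/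
theorem toy_reduce (Φ : Unit × Unit → ℝ) :
    supN (((2 / 3 : ℝ) • (1 : Matrix (Unit × Unit) (Unit × Unit) ℝ)) *ᵥ Φ)
      + ∑ μ : Unit, supN ((fun _ : Unit => (1 : Matrix (Unit × Unit) (Unit × Unit) ℝ)) μ
          *ᵥ (((2 / 3 : ℝ) • (1 : Matrix (Unit × Unit) (Unit × Unit) ℝ)) *ᵥ Φ))
      ≤ 2 * ((Fintype.card Unit + 1) * (1 / 2 : ℝ)) * supN Φ := by
  refine reduce_sup (G₀ := (1 / 2 : ℝ) • 1) (V := (1 / 2 : ℝ) • 1) (ε := 1 / 4) ?_ (by norm_num) ?_ ?_ ?_ ?_ Φ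
  · -- resolvent identity `2/3 = 1/2 + 1/2 · 1/2 · 2/3`
    rw [smul_mul_smul_comm, smul_mul_smul_comm, mul_one, mul_one, ← add_smul]
    norm_num
  · intro Ψ
    rw [smul_mulVec, one_mulVec, supN_unit, supN_unit, Pi.smul_apply, smul_eq_mul, abs_mul]
    norm_num
  · intro μ Ψ
    rw [one_mulVec, smul_mulVec, one_mulVec, supN_unit, supN_unit, Pi.smul_apply, smul_eq_mul, abs_mul]
    norm_num
  · intro u
    simp only [one_mulVec, univ_unique, sum_singleton]
    rw [smul_mulVec, one_mulVec, supN_unit, supN_unit, Pi.smul_apply, smul_eq_mul, abs_mul]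
    have := abs_nonneg (u ((), ()))
    norm_num
    linarith
  · simp; norm_num

end Instances

end

end Literature.MathematicalPhysics.QuantumFieldTheory.Balaban1983to89.B4Lemma22Reduce231
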